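import Mathlib
import HarnessLib

/-!
# ValiantsHypothesis / LacunarySymmetroid — crux `MatrixDescartes` (stmt-ValiantsHypothesis-18050, V1),
# line «osculation-law»: UNIFORM columns, part 2 — Vieta's sign test for a positive root, every degree

For a MONIC real polynomial `q`: a positive root forces some coefficient to be negative (no hypothesis), and
conversely, if `q` splits over `ℝ` (all roots real — the case of the gcd rows of a hyperbolic letter), a negative
coefficient forces a positive root (all roots `≤ 0` would make `q = ∏ (X + |β|)` coefficientwise nonnegative).
This replaces root continuity in the open-arc argument: «has a positive root» becomes the OPEN condition «some
coefficient is negative».  (Generalises `OsculationCuspGen.exists_pos_root`, the quadratic case, p609205.)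

Honest framing: helper algebra toward a UNIFORM Descartes ceiling for the osculation-law columns of an UNREGISTERED V1
law line; `OsculationLaw` (all `m`), `PeelInequality`, `MatrixDescartes`, Conjecture B and `VP ≠ VNP` are OPEN / NOT
proved.  No definitions, no named facts; Mathlib only.
-/

-- `Summit.ValiantsHypothesis.ValiantsHypothesis.…` is the tree's mandated single-conjunct layout (Sub = Summit).
set_option linter.dupNamespace false

noncomputable section

namespace Summit.ValiantsHypothesis.ValiantsHypothesis.Theorems.LacunarySymmetroidMatrixDescartes

namespace OsculationUniform

open Polynomial

/-- A product of factors `X + γ` with `γ ≥ 0` has nonnegative coefficients. [folklore] -/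
theorem coeff_prod_X_add_C_nonneg (m : Multiset ℝ) (hm : ∀ γ ∈ m, 0 ≤ γ) (i : ℕ) :
    0 ≤ ((m.map fun γ => X + C γ).prod).coeff i := by
  induction m using Multiset.induction_on generalizing i with
  | empty =>
    rw [Multiset.map_zero, Multiset.prod_zero, coeff_one]
    split_ifs <;> norm_num
  | cons γ m ih =>
    have hγ : 0 ≤ γ := hm γ (Multiset.mem_cons_self γ m)
    have hm' : ∀ γ' ∈ m, 0 ≤ γ' := fun γ' h => hm γ' (Multiset.mem_cons_of_mem h)
    rw [Multiset.map_cons, Multiset.prod_cons, add_mul, coeff_add, coeff_C_mul]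
    refine add_nonneg ?_ (mul_nonneg hγ (ih hm' i))
    rcases i with _ | i
    · rw [coeff_X_mul_zero]
    · rw [coeff_X_mul]; exact ih hm' i

/-- A monic real polynomial that splits and has all its roots `≤ 0` has nonnegative coefficients. [folklore] -/
theorem coeff_nonneg_of_roots_nonpos (q : ℝ[X]) (hq : q.Monic) (hs : q.Splits) (h : ∀ β ∈ q.roots, β ≤ 0)
    (i : ℕ) : 0 ≤ q.coeff i := by
  have e : q = ((q.roots.map fun β => -β).map fun γ => X + C γ).prod := by
    conv_lhs => rw [hs.eq_prod_roots_of_monic hq]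
    rw [Multiset.map_map]
    congr 1
    refine Multiset.map_congr rfl fun β _ => ?_
    simp [sub_eq_add_neg]
  rw [e]
  refine coeff_prod_X_add_C_nonneg _ (fun γ hγ => ?_) i
  obtain ⟨β, hβ, rfl⟩ := Multiset.mem_map.1 hγ
  have := h β hβ
  linarith

/-- **Vieta's sign test, converse half.**  A monic real polynomial which splits and has a negative coefficient has a
positive root. [folklore] -/
theorem exists_pos_root_of_coeff_neg (q : ℝ[X]) (hq : q.Monic) (hs : q.Splits) {i : ℕ} (hi : q.coeff i < 0) :
    ∃ b : ℝ, 0 < b ∧ q.IsRoot b := by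
  by_contra hcon
  push Not at hcon
  have hroots : ∀ β ∈ q.roots, β ≤ 0 := by
    intro β hβ
    by_contra hpos
    exact hcon β (lt_of_not_ge hpos) ((mem_roots hq.ne_zero).1 hβ)
  exact absurd (coeff_nonneg_of_roots_nonpos q hq hs hroots i) (not_le.2 hi)

/-- **Vieta's sign test, direct half.**  A monic real polynomial with a positive root has a negative coefficient
(if all coefficients were `≥ 0`, the value at `b > 0` would be `≥ b^deg > 0`). [folklore] -/
theorem exists_coeff_neg_of_pos_root (q : ℝ[X]) (hq : q.Monic) {b : ℝ} (hb : 0 < b) (hroot : q.IsRoot b) :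
    ∃ i : ℕ, q.coeff i < 0 := by
  by_contra hcon
  push Not at hcon
  have hval : q.eval b = ∑ i ∈ Finset.range (q.natDegree + 1), q.coeff i * b ^ i := eval_eq_sum_range b
  have hpos : 0 < ∑ i ∈ Finset.range (q.natDegree + 1), q.coeff i * b ^ i := by
    have hle : q.coeff q.natDegree * b ^ q.natDegree ≤ ∑ i ∈ Finset.range (q.natDegree + 1), q.coeff i * b ^ i :=
      Finset.single_le_sum (f := fun i => q.coeff i * b ^ i) (fun i _ => mul_nonneg (hcon i) (pow_nonneg hb.le i))
        (Finset.self_mem_range_succ q.natDegree)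
    have htop : q.coeff q.natDegree * b ^ q.natDegree = b ^ q.natDegree := by
      rw [coeff_natDegree, hq.leadingCoeff, one_mul]
    rw [htop] at hle
    exact lt_of_lt_of_le (pow_pos hb _) hle
  rw [← hval, hroot.eq_zero] at hpos
  exact lt_irrefl 0 hpos

/-- The two halves together: for a monic real polynomial that splits, «has a positive root» is the OPEN condition «some
coefficient is negative». [folklore] -/
theorem exists_pos_root_iff_coeff_neg (q : ℝ[X]) (hq : q.Monic) (hs : q.Splits) :
    (∃ b : ℝ, 0 < b ∧ q.IsRoot b) ↔ ∃ i : ℕ, q.coeff i < 0 :=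
  ⟨fun ⟨_, hb, hr⟩ => exists_coeff_neg_of_pos_root q hq hb hr, fun ⟨_, hi⟩ => exists_pos_root_of_coeff_neg q hq hs hi⟩

end OsculationUniform

end Summit.ValiantsHypothesis.ValiantsHypothesis.Theorems.LacunarySymmetroidMatrixDescartes
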